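import Mathlib
import Literature.Analysis.UnboundedOperators.ConjugateOperatorRegularity
import Literature.Analysis.UnboundedOperators.UnitaryRepSpectralMeasure
import Literature.Analysis.UnboundedOperators.FourierSpectrumCalculus
import HarnessLib
import Summits.AtomisticToContinuum.FouriersLaw.Theorems.EmbeddedDrudeMourreMourreDissolutionLAPDerivativeBound
import Summits.AtomisticToContinuum.FouriersLaw.Theorems.EmbeddedDrudeMourreMourreDissolutionLAPUniformCauchy

/-!
# Stub `stub_mourreThresholdLAP` — S6: Mourre's `C²` limiting absorption principle, Laplace form

Item `stmt-AtomisticToContinuum-12594` (crux `MourreDissolution` of route `EmbeddedDrudeMourre`,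
sub-problem `FouriersLaw`), line `separable-vertex-faddeev-pair-sector`, stub S6
`stub_mourreThresholdLAP` (Mourre 1981; Perry–Sigal–Simon 1981; ABG = Amrein–Boutet de
Monvel–Georgescu 1996, Thm. 7.3.1 in the `C²` case, here for the unbounded generator `H` of a
unitary group through its bounded resolvent, in Laplace form), THE REGISTERED STUB ITSELF,
closing the proof map S6-PLAN:

* F0 `…LAPGronwall` (modified Gronwall lemma), F1 `…LAPDissipativeResolvent{,Identities,Deriv}`
  (Mourre's dissipative resolvent `G_ε(z) = (H - z + iεM)⁻¹` in bounded form), F2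
  `…LAPQuadraticEstimate`, F3a `…LAPMourreCommutatorForm`, `…LAPEnergyLocalisation`, F3b
  `…LAPCommutatorExpansion{,Error}`, F4 `…LAPDifferentialInequality`, `…LAPDerivativeBound`
  (the differential inequality and the uniform bounds), F5 `…LAPUniformCauchy` (the
  `ε`-integration: uniform Cauchy property of `ν ↦ (ω ↦ i⟪ψ, R(ω - iν)ψ⟫)`), and the spectral
  dictionary `…LAPSpectralDictionary` / `…LAPCalculus`
  (`∫₀^∞ e^{-νt} e^{-iωt} ⟪ψ, U_t ψ⟫ dt = i⟪ψ, R(ω - iν) ψ⟫`, Cauchy criterion).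

Statement: for a one-parameter unitary group `U(t) = e^{itH}` with `H ∈ C¹(A)`, a strict Mourre
estimate on `(l, r)` and `φ(H)[H, iA]φ(H) ∈ C¹(A; H)` for admissible cutoffs, and `ψ ∈ D(A)`, the
Laplace–Fourier transforms `ω ↦ ∫₀^∞ e^{-νt} e^{-iωt} ⟪ψ, U_t ψ⟫ dt` converge uniformly on every
compact `[l', r'] ⊂ (l, r)` as `ν ↓ 0` to a continuous limit.
-/

noncomputable section

open MeasureTheory Complex Filter Topology Set
open scoped InnerProductSpace ComplexConjugate SchwartzMap ENNReal NNReal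

namespace Summit.AtomisticToContinuum.FouriersLaw.Theorems.MourreDissolution

open Literature.Analysis.UnboundedOperators
open Literature.Analysis.UnboundedOperators.UnitaryRep

/-- **Mourre's limiting absorption principle (`C²` form, Laplace version)** — the registered stub
`stub_mourreThresholdLAP` of line `separable-vertex-faddeev-pair-sector`: let `U(t) = e^{itH}`,
`W(x) = e^{iAx}` be one-parameter unitary groups with `H` of class `C¹(A)`, a strict Mourre
estimate `a φ(H)² ≤ φ(H)[H, iA]φ(H)` (`a > 0`) for all real cutoffs `φ ∈ C_c^∞((l, r))`, and
`φ(H)[H, iA]φ(H) ∈ C¹(A; H)` for these cutoffs (Mourre's `C²`-type hypothesis). Then for every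
`ψ ∈ D(A)` and every compact window `[l', r'] ⊂ (l, r)` the Laplace–Fourier transforms
`G_ν(ω) = ∫₀^∞ e^{-νt} e^{-iωt} ⟪ψ, U_t ψ⟫ dt = i⟪ψ, (H - ω + iν)⁻¹ ψ⟫` converge, as `ν ↓ 0`,
uniformly on `[l', r']` to a continuous function (the boundary value of the resolvent).
Proof: Mourre's differential-inequality method (ABG Thm. 7.3.1 with `S_ε = M`): the uniform
bounds of `…LAPDerivativeBound`, the `ε`-integration of `…LAPUniformCauchy`, and the Cauchy
criterion of `…LAPSpectralDictionary`.
[cite: AmreinBoutetdeMonvelGeorgescu1996, Thm. 7.3.1] -/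
theorem stub_mourreThresholdLAP :
    ∀ (K : Type) [NormedAddCommGroup K] [InnerProductSpace ℂ K] [CompleteSpace K]
      (U A : Literature.Analysis.UnboundedOperators.OneParameterUnitaryGroup K) (l r a : ℝ),
      l < r → 0 < a → U.HamiltonianOfClassC1 A →
      U.HasMourreEstimateOn A (Set.Ioo l r) a →
      (∀ g : SchwartzMap ℝ ℂ, Literature.Analysis.UnboundedOperators.UnitaryRep.IsRealCutoffOn (Set.Ioo l r) g →
        A.IsOfClassC1 (U.mourreCommutator A g)) →
      ∀ ψ : K, ψ ∈ A.hamiltonian.domain →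
        ∀ l' r' : ℝ, l < l' → l' ≤ r' → r' < r →
          ∃ G : ℝ → ℂ, ContinuousOn G (Set.Icc l' r') ∧
            TendstoUniformlyOn
              (fun (ν : ℝ) (ω : ℝ) =>
                MeasureTheory.integral (MeasureTheory.volume.restrict (Set.Ioi (0:ℝ)))
                  (fun t : ℝ => ((Real.exp (-(ν * t)) : ℝ) : ℂ) *
                    Complex.exp (-(Complex.I * ((ω * t : ℝ) : ℂ))) * ⟪ψ, U.appReal t ψ⟫_ℂ))
              G (nhdsWithin (0:ℝ) (Set.Ioi 0)) (Set.Icc l' r') := by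
  intro K _ _ _ U A l r a _ ha hC1 hMourre hC2 ψ hψ l' r' hl hl' hr
  obtain ⟨M, ε₀, C, κ, hM, hε₀, hκi, hC, hκ⟩ :=
    exists_mourre_derivative_bounds ha hC1 hMourre hC2 hψ hl hl' hr
  exact exists_limit_of_uniformCauchySeqOn_laplaceFourier U ψ
    (laplaceFourier_uniformCauchy_of_bounds K U M ψ (Set.Icc l' r') ε₀ C κ hM hε₀ hκi hC hκ)

end Summit.AtomisticToContinuum.FouriersLaw.Theorems.MourreDissolution
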